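import Summits.ResolutionOfSingularities.ResolutionOfSingularities.Theorems.WeightedInvariantLocalWeightedDropNCToricRung
import Summits.ResolutionOfSingularities.ResolutionOfSingularities.Theorems.WeightedInvariantLocalWeightedDropNCGameToricCalculus

/-!
# TOT rung R6 (toric / Newton non-degenerate), step (b): `NCTransport.toricStep` — a toric move of the count game leads to a toric state

Crux item stmt-ResolutionOfSingularities-8899 `WeightedInvariant.LocalWeightedDrop` (route `ResolutionOfSingularities/WeightedInvariant`), line
`nc-game-transport` (strategist res-L1-w43-strat-1), TOT rung R6 `NCTransport.TOTRungNonDegenerate` (tree file `…NCToricRung` = the strategist's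
sketch 5d6b0cd95af99ede, whose assembly `totRungNonDegenerate_of_toric : ToricStep m → ToricEnd m → TOTRungNonDegenerate m` is proved there).
[OURS · L1 W4.3 · seat res-D-pv-006; def-free; NOT a statement of any manuscript.]

`theorem toricStep (m : ℕ) : NCTransport.ToricStep m` — for a toric state `st : ToricState b B` (position `B = v·X^c·h`, total transform
`b∘x = X^d·h` for `x_i = X^{cols·i}·u_i`, invertible log-Jacobian) and a centre `∅ ≠ J ⊆ T` of toric slots, the move `(Φ = X, w = 𝟙_J)` satisfies the
game's `MoveClause` with goodness «the new position admits a toric state whose cloud on `S₀` is `MonomialCloud.succ J l Z 0 ∘ (old cloud)`, re-indexed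
by `TupleMonomialPhase.sigma l`».  Construction of the successor state at the opponent's answer `c` (supported on `J`, `c ≠ 0`), any factorisation
`B∘chart = s^A·G`, `s ∤ G`:
* live slot `l` := any slot with `c_l ≠ 0`; translated slots `Z := {j ∈ J ∖ l : c_j ≠ 0}`; `θ := slice_l ∘ chart` (`…NCGameToricCalculus`);
* `toricStep_saturation`: the `s`-saturation `h∘chart = s^a·F̃` (`exists_eq_X_pow_mul_not_dvd`) and uniqueness of saturations
  (`X_pow_mul_eq_X_pow_mul`) give `G = Q·F̃` with `Q = v∘chart · ∏_t (c_t + y′_t)^{c_t}` EXACTLY;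
* `toricStep_pos`: the new position is `s · slice_l G = v′ · X^{c′} · h′` with ONE `h′ := U(d) · slice_l F̃` (the unit `U(d)` of the product formula is
  moved into `h′` and compensated in `v′` by `U(d)⁻¹`), and `toricStep_total`: `b∘x′ = (b∘x)∘θ = ∏ θ_t^{d_t} · (s^a · slice_l F̃) = X^{d′} · h′`;
* `toricStep_logJac`: with `cols′ = (Σ_{t∈J} cols_t ; cols_{l⁺(q)}·[c_{l⁺(q)} = 0])`, toric slots `T′ = {0} ∪ {q⁺ : l⁺(q) ∈ T, c_{l⁺(q)} = 0}` and units
  `u′_i = U(cols·i) · u_i∘θ`, the new log-Jacobian matrix is `diag(1; c_{l⁺(q)}⁻¹ on Z, 1 elsewhere) · P_σ · (old matrix with the rows of J added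
  into row l)` entrywise (`logCoeff_unitPart`, `coeff_single_succ_subst_slice_chart`), hence invertible (`isUnit_det_of_rowOps`);
* `toricStep_cloud`: the cloud of `cols′` is `succ J l Z 0 ∘ (cloud of cols) ∘ σ`.
The rung itself (`totRungNonDegenerate`) is closed in `…NCToricRungClosed` through res-type-088's (c) `toricEnd`.
-/

set_option linter.dupNamespace false -- mandated namespace of this single-conjunct summit

namespace Summit.ResolutionOfSingularities.ResolutionOfSingularities.Theorems

namespace NCTransport

open MvPowerSeries Literature.AlgebraicGeometry.Resolution TameFourTupleDrop

variable {k : Type} [Field k]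

/-! ## (1) The saturation of `B∘chart` -/

/-- THE FACTORISATION OF THE TRANSFORMED POSITION: if `B = v·X^c·h` (toric state) and `B∘chart_{𝟙_J,c} = s^A·G` with `s ∤ G`, then
`G = (v∘chart · ∏_t (c_t + y′_t)^{c_t}) · F̃` where `h∘chart = s^a·F̃` is the `s`-saturation of the transformed `h`. -/
theorem toricStep_saturation {m : ℕ} {b B : MvPowerSeries (Fin (m + 1)) k} (st : ToricState b B) (J : Finset (Fin (m + 1)))
    (c : Fin (m + 1) → k) (hc : ∀ i, (if i ∈ J then 1 else 0) = 0 → c i = 0) {A : ℕ} {G : MvPowerSeries (Fin (m + 1 + 1)) k}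
    (hfac : subst (CobordantChart.chart (fun i => if i ∈ J then 1 else 0) c) (subst (fun i => (X i : MvPowerSeries (Fin (m + 1)) k)) B) =
      X 0 ^ A * G) (hG : ¬ X 0 ∣ G) :
    ∃ (a : ℕ) (Ft : MvPowerSeries (Fin (m + 1 + 1)) k), ¬ X 0 ∣ Ft ∧
      subst (CobordantChart.chart (fun i => if i ∈ J then 1 else 0) c) st.h = X 0 ^ a * Ft ∧
      G = (subst (CobordantChart.chart (fun i => if i ∈ J then 1 else 0) c) st.v * ∏ t, (C (c t) + X t.succ) ^ st.c t) * Ft := by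
  classical
  have hchs := CobordantChart.hasSubst_chart (fun i => if i ∈ J then 1 else 0) c hc
  obtain ⟨ch, hch⟩ : ∃ ch : Fin (m + 1) → MvPowerSeries (Fin (m + 1 + 1)) k,
      ch = CobordantChart.chart (fun i => if i ∈ J then 1 else 0) c := ⟨_, rfl⟩
  obtain ⟨Q, hQ⟩ : ∃ Q : MvPowerSeries (Fin (m + 1 + 1)) k, Q = subst ch st.v * ∏ t, (C (c t) + X t.succ) ^ st.c t := ⟨_, rfl⟩
  rw [← hch] at hfac ⊢
  rw [← hQ]
  have hBch : subst ch B = X 0 ^ (∑ t, (if t ∈ J then 1 else 0) * st.c t) * Q * subst ch st.h := by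
    conv_lhs => rw [st.pos_eq]
    rw [hQ, hch, subst_mul hchs, TupleMonomialPhase.subst_chart_unitMonomial _ c hc st.v st.c]
  have hsubstX : subst (fun i => (X i : MvPowerSeries (Fin (m + 1)) k)) B = B := congrFun subst_self B
  have hfac' : X 0 ^ A * G = X 0 ^ (∑ t, (if t ∈ J then 1 else 0) * st.c t) * Q * subst ch st.h := by
    rw [← hfac, hsubstX, hBch]
  have hF0 : subst ch st.h ≠ 0 := by
    intro h0
    apply hG
    rw [h0, mul_zero] at hfac'
    rw [(mul_eq_zero.mp hfac').resolve_left (pow_ne_zero _ (FormalCoordChange.X_ne_zero' 0))]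
    exact dvd_zero _
  obtain ⟨a, Ft, hFa, hFt⟩ := exists_eq_X_pow_mul_not_dvd 0 hF0
  have hvcc : constantCoeff (subst ch st.v) ≠ 0 := by
    rw [hch, TupleMonomialPhase.constantCoeff_subst_chart _ c hc]; exact st.v_unit
  have hQX : ¬ X 0 ∣ Q := by rw [hQ]; exact TupleMonomialPhase.not_X_dvd_bracket hvcc c st.c
  have hprime := MvPowerSeries.prime_X' k (0 : Fin (m + 1 + 1))
  have hQF : ¬ X 0 ∣ Q * Ft := fun h => (hprime.dvd_or_dvd h).elim hQX hFt
  obtain ⟨-, hGQ⟩ : A = (∑ t, (if t ∈ J then 1 else 0) * st.c t + a) ∧ G = Q * Ft := by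
    refine X_pow_mul_eq_X_pow_mul 0 ?_ hG hQF
    rw [hfac', hFa]; ring
  exact ⟨a, Ft, hFt, hFa, hGQ⟩

/-! ## (2) The new position and the new total transform -/

open scoped Classical in
/-- THE NEW POSITION: `s · slice_l ((V · ∏ (c_t + y′_t)^{c_t}) · F̃) = v′ · X^{c′} · h′` with `h′ = U(d) · slice_l F̃`,
`v′ = slice_l V · U(c) · U(d)⁻¹`, `c′ = (1 ; c_{l⁺(q)}·[c_{l⁺(q)} = 0])`. -/
theorem toricStep_pos {m : ℕ} (c : Fin (m + 1) → k) {l : Fin (m + 1)} (hcl : c l ≠ 0)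
    (V Ft : MvPowerSeries (Fin (m + 1 + 1)) k) (ce de : Fin (m + 1) → ℕ) :
    X 0 * TupleGame.slice l ((V * ∏ t, (C (c t) + X t.succ) ^ ce t) * Ft) =
      (TupleGame.slice l V *
          (C (c l) ^ ce l * ∏ q : Fin m, (if c (l.succAbove q) = 0 then (1 : MvPowerSeries (Fin (m + 1)) k)
            else C (c (l.succAbove q)) + X q.succ) ^ ce (l.succAbove q)) *
          (C (c l) ^ de l * ∏ q : Fin m, (if c (l.succAbove q) = 0 then (1 : MvPowerSeries (Fin (m + 1)) k)
            else C (c (l.succAbove q)) + X q.succ) ^ de (l.succAbove q))⁻¹) *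
        (∏ t, (X t : MvPowerSeries (Fin (m + 1)) k) ^
          (Fin.cases 1 (fun q => if c (l.succAbove q) = 0 then ce (l.succAbove q) else 0) t : ℕ)) *
        ((C (c l) ^ de l * ∏ q : Fin m, (if c (l.succAbove q) = 0 then (1 : MvPowerSeries (Fin (m + 1)) k)
            else C (c (l.succAbove q)) + X q.succ) ^ de (l.succAbove q)) * TupleGame.slice l Ft) := by
  obtain ⟨U, hU⟩ : ∃ U : (Fin (m + 1) → ℕ) → MvPowerSeries (Fin (m + 1)) k,
      U = fun e => C (c l) ^ e l * ∏ q : Fin m, (if c (l.succAbove q) = 0 then (1 : MvPowerSeries (Fin (m + 1)) k)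
        else C (c (l.succAbove q)) + X q.succ) ^ e (l.succAbove q) := ⟨_, rfl⟩
  have hUc : (C (c l) ^ ce l * ∏ q : Fin m, (if c (l.succAbove q) = 0 then (1 : MvPowerSeries (Fin (m + 1)) k)
      else C (c (l.succAbove q)) + X q.succ) ^ ce (l.succAbove q)) = U ce := by rw [hU]
  have hUd : (C (c l) ^ de l * ∏ q : Fin m, (if c (l.succAbove q) = 0 then (1 : MvPowerSeries (Fin (m + 1)) k)
      else C (c (l.succAbove q)) + X q.succ) ^ de (l.succAbove q)) = U de := by rw [hU]
  have hinv : (U de)⁻¹ * U de = 1 := MvPowerSeries.inv_mul_cancel _ (by rw [hU]; exact constantCoeff_unitPart c hcl de)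
  have hsliceQ : TupleGame.slice l (V * ∏ t, (C (c t) + X t.succ) ^ ce t) = TupleGame.slice l V *
      (U ce * ∏ q : Fin m, (X q.succ : MvPowerSeries (Fin (m + 1)) k) ^ (if c (l.succAbove q) = 0 then ce (l.succAbove q) else 0)) := by
    rw [TupleMonomialPhase.slice_mul, TupleMonomialPhase.slice_prod]
    simp_rw [TupleMonomialPhase.slice_pow, TupleMonomialPhase.slice_add, TupleMonomialPhase.slice_C]
    rw [prod_slice_linear_pow c l ce, hU]
  rw [hUc, hUd, TupleMonomialPhase.slice_mul, hsliceQ, ← X_pow_mul_prod_succ_eq 1, pow_one]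
  calc X 0 * (TupleGame.slice l V * (U ce * ∏ q : Fin m, (X q.succ : MvPowerSeries (Fin (m + 1)) k) ^
        (if c (l.succAbove q) = 0 then ce (l.succAbove q) else 0)) * TupleGame.slice l Ft)
      = ((U de)⁻¹ * U de) * (X 0 * (TupleGame.slice l V * (U ce * ∏ q : Fin m,
          (X q.succ : MvPowerSeries (Fin (m + 1)) k) ^ (if c (l.succAbove q) = 0 then ce (l.succAbove q) else 0)) *
            TupleGame.slice l Ft)) := by rw [hinv, one_mul]
    _ = _ := by ring

open scoped Classical in
/-- THE NEW TOTAL TRANSFORM: with `x′_i = X^{cols′·i} · (U(cols·i) · u_i∘θ)` one has `b∘x′ = (b∘x)∘θ = X^{d′} · (U(d) · slice_l F̃)`, where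
`h∘chart = s^a · F̃` and `d′ = (Σ_{t∈J} d_t + a ; d_{l⁺(q)}·[c_{l⁺(q)} = 0])`. -/
theorem toricStep_total {m : ℕ} {b B : MvPowerSeries (Fin (m + 1)) k} (st : ToricState b B) (J : Finset (Fin (m + 1)))
    (c : Fin (m + 1) → k) (hc : ∀ i, (if i ∈ J then 1 else 0) = 0 → c i = 0) (l : Fin (m + 1)) {a : ℕ}
    {Ft : MvPowerSeries (Fin (m + 1 + 1)) k}
    (hFa : subst (CobordantChart.chart (fun i => if i ∈ J then 1 else 0) c) st.h = X 0 ^ a * Ft) :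
    subst (fun i => (∏ t', (X t' : MvPowerSeries (Fin (m + 1)) k) ^
        (Fin.cases (∑ t ∈ J, st.cols t i) (fun q => if c (l.succAbove q) = 0 then st.cols (l.succAbove q) i else 0) t' : ℕ)) *
      ((C (c l) ^ st.cols l i * ∏ q : Fin m, (if c (l.succAbove q) = 0 then (1 : MvPowerSeries (Fin (m + 1)) k)
          else C (c (l.succAbove q)) + X q.succ) ^ st.cols (l.succAbove q) i) *
        subst (fun t => TupleGame.slice l (CobordantChart.chart (fun i => if i ∈ J then 1 else 0) c t)) (st.u i))) b =
      (∏ t', (X t' : MvPowerSeries (Fin (m + 1)) k) ^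
        (Fin.cases (∑ t ∈ J, st.d t + a) (fun q => if c (l.succAbove q) = 0 then st.d (l.succAbove q) else 0) t' : ℕ)) *
      ((C (c l) ^ st.d l * ∏ q : Fin m, (if c (l.succAbove q) = 0 then (1 : MvPowerSeries (Fin (m + 1)) k)
          else C (c (l.succAbove q)) + X q.succ) ^ st.d (l.succAbove q)) * TupleGame.slice l Ft) := by
  obtain ⟨θ, hθ⟩ : ∃ θ : Fin (m + 1) → MvPowerSeries (Fin (m + 1)) k,
      θ = fun t => TupleGame.slice l (CobordantChart.chart (fun i => if i ∈ J then 1 else 0) c t) := ⟨_, rfl⟩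
  obtain ⟨U, hU⟩ : ∃ U : (Fin (m + 1) → ℕ) → MvPowerSeries (Fin (m + 1)) k,
      U = fun e => C (c l) ^ e l * ∏ q : Fin m, (if c (l.succAbove q) = 0 then (1 : MvPowerSeries (Fin (m + 1)) k)
        else C (c (l.succAbove q)) + X q.succ) ^ e (l.succAbove q) := ⟨_, rfl⟩
  have hUcols : ∀ i, (C (c l) ^ st.cols l i * ∏ q : Fin m, (if c (l.succAbove q) = 0 then (1 : MvPowerSeries (Fin (m + 1)) k)
      else C (c (l.succAbove q)) + X q.succ) ^ st.cols (l.succAbove q) i) = U (fun t => st.cols t i) := fun i => by rw [hU]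
  have hUd : (C (c l) ^ st.d l * ∏ q : Fin m, (if c (l.succAbove q) = 0 then (1 : MvPowerSeries (Fin (m + 1)) k)
      else C (c (l.succAbove q)) + X q.succ) ^ st.d (l.succAbove q)) = U st.d := by rw [hU]
  have hθs : HasSubst θ := by rw [hθ]; exact hasSubst_slice_chart _ c hc l
  have hprodθ : ∀ e : Fin (m + 1) → ℕ, (∏ t, θ t ^ e t) = U e * ∏ t, (X t : MvPowerSeries (Fin (m + 1)) k) ^
      (Fin.cases (∑ t ∈ J, e t) (fun q => if c (l.succAbove q) = 0 then e (l.succAbove q) else 0) t : ℕ) := fun e => by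
    rw [hU, hθ]; exact prod_slice_chart_pow J c l e
  have hθh : subst θ st.h = X 0 ^ a * TupleGame.slice l Ft := by
    rw [hθ, ← slice_subst_chart _ c hc l st.h, hFa, TupleMonomialPhase.slice_mul, TupleMonomialPhase.slice_pow,
      TupleMonomialPhase.slice_X_zero]
  have hx : HasSubst (fun i => (∏ t, X t ^ st.cols t i) * st.u i : Fin (m + 1) → MvPowerSeries (Fin (m + 1)) k) := by
    refine hasSubst_of_constantCoeff_zero fun i => ?_
    obtain ⟨t, -, hpos⟩ := st.col_pos i
    rw [map_mul, map_prod, Finset.prod_eq_zero (Finset.mem_univ t) (by rw [map_pow, constantCoeff_X, zero_pow hpos.ne']),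
      zero_mul]
  simp_rw [hUcols]
  rw [← hθ, hUd]
  have hxθ : (fun i => (∏ t', (X t' : MvPowerSeries (Fin (m + 1)) k) ^ (Fin.cases (∑ t ∈ J, st.cols t i)
      (fun q => if c (l.succAbove q) = 0 then st.cols (l.succAbove q) i else 0) t' : ℕ)) *
        (U (fun t => st.cols t i) * subst θ (st.u i))) =
      fun i => subst θ ((∏ t, X t ^ st.cols t i) * st.u i) := by
    funext i
    rw [subst_mul hθs, ← coe_substAlgHom hθs, map_prod]
    simp_rw [map_pow, coe_substAlgHom hθs, subst_X hθs]
    rw [hprodθ (fun t => st.cols t i)]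
    ring
  rw [hxθ, ← subst_comp_subst_apply hx hθs, st.total_eq, subst_mul hθs, ← coe_substAlgHom hθs, map_prod]
  simp_rw [map_pow, coe_substAlgHom hθs, subst_X hθs]
  rw [hprodθ st.d, hθh, ← X_pow_mul_prod_succ_eq, ← X_pow_mul_prod_succ_eq]
  ring

/-! ## (3) The new log-Jacobian matrix -/

open scoped Classical in
/-- THE NEW LOG-JACOBIAN MATRIX IS INVERTIBLE: it is `diag(D) · P_σ · (old matrix with the rows of J added into row l)` with `D = 1` except
`D = c_{l⁺(q)}⁻¹` on the translated slots. -/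
theorem toricStep_logJac {m : ℕ} {b B : MvPowerSeries (Fin (m + 1)) k} (st : ToricState b B) {J : Finset (Fin (m + 1))}
    (hJT : J ⊆ st.T) (c : Fin (m + 1) → k) (hc : ∀ i, (if i ∈ J then 1 else 0) = 0 → c i = 0) {l : Fin (m + 1)} (hlJ : l ∈ J)
    (hcl : c l ≠ 0) :
    IsUnit (Matrix.det (Matrix.of fun t' i : Fin (m + 1) =>
      if t' ∈ Finset.univ.filter (fun t' => Fin.cases (motive := fun _ => Prop) True
          (fun q => l.succAbove q ∈ st.T ∧ c (l.succAbove q) = 0) t')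
      then (((Fin.cases (∑ t ∈ J, st.cols t i) (fun q => if c (l.succAbove q) = 0 then st.cols (l.succAbove q) i else 0) t' : ℕ)) : k)
      else coeff (Finsupp.single t' 1)
          ((C (c l) ^ st.cols l i * ∏ q : Fin m, (if c (l.succAbove q) = 0 then (1 : MvPowerSeries (Fin (m + 1)) k)
              else C (c (l.succAbove q)) + X q.succ) ^ st.cols (l.succAbove q) i) *
            subst (fun t => TupleGame.slice l (CobordantChart.chart (fun i => if i ∈ J then 1 else 0) c t)) (st.u i)) *
        (constantCoeff ((C (c l) ^ st.cols l i * ∏ q : Fin m, (if c (l.succAbove q) = 0 then (1 : MvPowerSeries (Fin (m + 1)) k)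
              else C (c (l.succAbove q)) + X q.succ) ^ st.cols (l.succAbove q) i) *
            subst (fun t => TupleGame.slice l (CobordantChart.chart (fun i => if i ∈ J then 1 else 0) c t)) (st.u i)))⁻¹)) := by
  have hcJ : ∀ i, c i ≠ 0 → i ∈ J := fun i hi => by
    by_contra h
    exact hi (hc i (if_neg h))
  have hUcc : ∀ i, constantCoeff (C (c l) ^ st.cols l i * ∏ q : Fin m, (if c (l.succAbove q) = 0 then
      (1 : MvPowerSeries (Fin (m + 1)) k) else C (c (l.succAbove q)) + X q.succ) ^ st.cols (l.succAbove q) i) ≠ 0 :=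
    fun i => constantCoeff_unitPart c hcl (fun t => st.cols t i)
  have hθucc : ∀ i, constantCoeff (subst (fun t => TupleGame.slice l (CobordantChart.chart (fun i => if i ∈ J then 1 else 0) c t))
      (st.u i)) ≠ 0 := fun i => by
    rw [constantCoeff_subst_slice_chart _ c hc l]; exact st.u_unit i
  have hT0 : (0 : Fin (m + 1)) ∈ Finset.univ.filter (fun t' => Fin.cases (motive := fun _ => Prop) True
      (fun q => l.succAbove q ∈ st.T ∧ c (l.succAbove q) = 0) t') := by
    rw [Finset.mem_filter]
    refine ⟨Finset.mem_univ _, ?_⟩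
    simp only [Fin.cases_zero]
  have hTsucc : ∀ q : Fin m, q.succ ∈ Finset.univ.filter (fun t' => Fin.cases (motive := fun _ => Prop) True
      (fun q => l.succAbove q ∈ st.T ∧ c (l.succAbove q) = 0) t') ↔ l.succAbove q ∈ st.T ∧ c (l.succAbove q) = 0 := fun q => by
    rw [Finset.mem_filter]
    simp only [Fin.cases_succ]
    exact ⟨fun h => h.2, fun h => ⟨Finset.mem_univ _, h⟩⟩
  refine isUnit_det_of_rowOps st.logJac (TupleMonomialPhase.sigma l) l (fun s => if s ∈ J then (1 : k) else 0) (if_pos hlJ)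
    (Fin.cases (1 : k) (fun q => if c (l.succAbove q) = 0 then 1 else (c (l.succAbove q))⁻¹)) ?_ ?_
  · intro t'
    induction t' using Fin.cases with
    | zero => simp only [Fin.cases_zero]; exact one_ne_zero
    | succ q =>
      simp only [Fin.cases_succ]
      split_ifs with h0
      · exact one_ne_zero
      · exact inv_ne_zero h0
  · intro t' i
    rw [Matrix.of_apply]
    induction t' using Fin.cases with
    | zero =>
      -- the new toric row `s`: the sum of the old rows of `J`
      simp only [Fin.cases_zero]
      rw [if_pos hT0, one_mul, TupleMonomialPhase.sigma_zero, Matrix.updateRow_self, Finset.sum_apply, Nat.cast_sum]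
      simp_rw [Pi.smul_apply, smul_eq_mul, ite_mul, one_mul, zero_mul]
      rw [← Finset.sum_filter, Finset.filter_mem_eq_inter, Finset.univ_inter]
      refine Finset.sum_congr rfl fun s hs => ?_
      rw [Matrix.of_apply, if_pos (hJT hs)]
    | succ q =>
      simp only [Fin.cases_succ]
      rw [TupleMonomialPhase.sigma_succ, Matrix.updateRow_ne (Fin.succAbove_ne l q), Matrix.of_apply]
      have hlog := logCoeff_unitPart c hcl (fun t => st.cols t i) q
      have hlin := coeff_single_succ_subst_slice_chart J c hc l (st.u i) q
      beta_reduce at hlog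
      by_cases h0 : c (l.succAbove q) = 0
      · rw [if_pos h0, if_pos h0, one_mul]
        by_cases hT : l.succAbove q ∈ st.T
        · -- an untouched toric slot
          rw [if_pos ((hTsucc q).mpr ⟨hT, h0⟩), if_pos hT]
        · -- an old log slot (`∉ T`, hence `∉ J`): its log row is unchanged
          have hJ' : l.succAbove q ∉ J := fun h => hT (hJT h)
          rw [if_neg (fun h => hT ((hTsucc q).mp h).1), if_neg hT, logCoeff_mul q.succ (hUcc i) (hθucc i), hlog, if_pos h0, zero_add,
            hlin, if_neg hJ', constantCoeff_subst_slice_chart _ c hc l]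
      · -- a translated slot (`∈ Z ⊆ J ⊆ T`): the old toric row divided by `c`
        have hJq : l.succAbove q ∈ J := hcJ _ h0
        rw [if_neg (fun h => h0 ((hTsucc q).mp h).2), if_neg h0, if_pos (hJT hJq), logCoeff_mul q.succ (hUcc i) (hθucc i), hlog,
          if_neg h0, hlin, if_pos hJq, zero_mul, add_zero, mul_comm]

/-! ## (4) The new cloud -/

open scoped Classical in
/-- THE CLOUD OF THE NEW EXPONENT MATRIX `cols′ = (Σ_{t∈J} cols_t ; cols_{l⁺(q)}·[c_{l⁺(q)} = 0])` is `succ J l Z 0` of the old cloud, re-indexed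
by `sigma l` (`Z = {j ∈ J ∖ l : c_j ≠ 0}`). -/
theorem toricStep_cloud {m : ℕ} (cols : Fin (m + 1) → Fin (m + 1) → ℕ) (J : Finset (Fin (m + 1))) (c : Fin (m + 1) → k)
    (hcJ : ∀ i, c i ≠ 0 → i ∈ J) (l : Fin (m + 1)) {S : Type} (x : S → Fin (m + 1) → ℕ) :
    (fun s t' => ∑ i, (Fin.cases (∑ t ∈ J, cols t i) (fun q => if c (l.succAbove q) = 0 then cols (l.succAbove q) i else 0) t' : ℕ) *
        x s i) =
      fun s => MonomialCloud.succ J l ((J.erase l).filter (fun i => c i ≠ 0)) 0 (fun t => ∑ i, cols t i * x s i) ∘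
        TupleMonomialPhase.sigma l := by
  have hmemZ : ∀ q : Fin m, l.succAbove q ∈ (J.erase l).filter (fun i => c i ≠ 0) ↔ c (l.succAbove q) ≠ 0 := fun q => by
    rw [Finset.mem_filter, Finset.mem_erase]
    exact ⟨fun h => h.2, fun h => ⟨⟨Fin.succAbove_ne l q, hcJ _ h⟩, h⟩⟩
  funext s t'
  rw [Function.comp_apply]
  induction t' using Fin.cases with
  | zero =>
    simp only [Fin.cases_zero]
    rw [TupleMonomialPhase.sigma_zero]
    unfold MonomialCloud.succ
    rw [if_pos rfl, Nat.sub_zero]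
    simp_rw [Finset.sum_mul]
    rw [Finset.sum_comm]
  | succ q =>
    simp only [Fin.cases_succ]
    rw [TupleMonomialPhase.sigma_succ]
    unfold MonomialCloud.succ
    rw [if_neg (Fin.succAbove_ne l q)]
    by_cases h0 : c (l.succAbove q) = 0
    · rw [if_neg (fun h => (hmemZ q).mp h h0)]
      simp_rw [if_pos h0]
    · rw [if_pos ((hmemZ q).mpr h0)]
      simp_rw [if_neg h0, zero_mul, Finset.sum_const_zero]

/-! ## (5) The toric step -/

/-- **(b) THE TORIC STEP** of TOT rung R6: blowing up a toric centre `{X_j = 0 : j ∈ J}`, `∅ ≠ J ⊆ T`, is a move of the count game all of whose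
successor positions admit a toric state with cloud `succ J l Z 0 ∘ σ` of the old cloud.  Every field; no characteristic hypothesis. -/
theorem toricStep (m : ℕ) : ToricStep m := by
  intro k _ b B st S₀ J hJne hJT c hc hc0 A G hfac hG
  classical
  -- the live slot `l` (any slot with `c_l ≠ 0`; it lies in `J`)
  obtain ⟨l, hcl⟩ : ∃ l, c l ≠ 0 := by
    by_contra h
    exact hc0 (funext fun i => not_not.mp (not_exists.mp h i))
  have hcJ : ∀ i, c i ≠ 0 → i ∈ J := fun i hi => by
    by_contra h
    exact hi (hc i (if_neg h))
  have hlJ : l ∈ J := hcJ l hcl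
  -- the saturation data
  obtain ⟨a, Ft, -, hFa, hGQ⟩ := toricStep_saturation st J c hc hfac hG
  have hvcc : constantCoeff (subst (CobordantChart.chart (fun i => if i ∈ J then 1 else 0) c) st.v) ≠ 0 := by
    rw [TupleMonomialPhase.constantCoeff_subst_chart _ c hc]; exact st.v_unit
  -- membership in the new toric slots
  have hT0 : (0 : Fin (m + 1)) ∈ Finset.univ.filter (fun t' => Fin.cases (motive := fun _ => Prop) True
      (fun q => l.succAbove q ∈ st.T ∧ c (l.succAbove q) = 0) t') := by
    rw [Finset.mem_filter]
    refine ⟨Finset.mem_univ _, ?_⟩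
    simp only [Fin.cases_zero]
  have hTsucc : ∀ q : Fin m, q.succ ∈ Finset.univ.filter (fun t' => Fin.cases (motive := fun _ => Prop) True
      (fun q => l.succAbove q ∈ st.T ∧ c (l.succAbove q) = 0) t') ↔ l.succAbove q ∈ st.T ∧ c (l.succAbove q) = 0 := fun q => by
    rw [Finset.mem_filter]
    simp only [Fin.cases_succ]
    exact ⟨fun h => h.2, fun h => ⟨Finset.mem_univ _, h⟩⟩
  -- the successor state
  refine ⟨l, hcl, ⟨{
      T := Finset.univ.filter (fun t' => Fin.cases (motive := fun _ => Prop) True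
        (fun q => l.succAbove q ∈ st.T ∧ c (l.succAbove q) = 0) t'),
      cols := fun t' i => Fin.cases (∑ t ∈ J, st.cols t i)
        (fun q => if c (l.succAbove q) = 0 then st.cols (l.succAbove q) i else 0) t',
      cols_zero := ?_,
      col_pos := ?_,
      u := fun i => (C (c l) ^ st.cols l i * ∏ q : Fin m, (if c (l.succAbove q) = 0 then (1 : MvPowerSeries (Fin (m + 1)) k)
          else C (c (l.succAbove q)) + X q.succ) ^ st.cols (l.succAbove q) i) *
        subst (fun t => TupleGame.slice l (CobordantChart.chart (fun i => if i ∈ J then 1 else 0) c t)) (st.u i),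
      u_unit := fun i => by
        rw [map_mul, constantCoeff_subst_slice_chart _ c hc l]
        exact mul_ne_zero (constantCoeff_unitPart c hcl (fun t => st.cols t i)) (st.u_unit i),
      logJac := by exact toricStep_logJac st hJT c hc hlJ hcl,
      h := (C (c l) ^ st.d l * ∏ q : Fin m, (if c (l.succAbove q) = 0 then (1 : MvPowerSeries (Fin (m + 1)) k)
          else C (c (l.succAbove q)) + X q.succ) ^ st.d (l.succAbove q)) * TupleGame.slice l Ft,
      v := TupleGame.slice l (subst (CobordantChart.chart (fun i => if i ∈ J then 1 else 0) c) st.v) *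
          (C (c l) ^ st.c l * ∏ q : Fin m, (if c (l.succAbove q) = 0 then (1 : MvPowerSeries (Fin (m + 1)) k)
            else C (c (l.succAbove q)) + X q.succ) ^ st.c (l.succAbove q)) *
          (C (c l) ^ st.d l * ∏ q : Fin m, (if c (l.succAbove q) = 0 then (1 : MvPowerSeries (Fin (m + 1)) k)
            else C (c (l.succAbove q)) + X q.succ) ^ st.d (l.succAbove q))⁻¹,
      v_unit := by
        rw [map_mul, map_mul, TupleMonomialPhase.constantCoeff_slice, MvPowerSeries.constantCoeff_inv]
        exact mul_ne_zero (mul_ne_zero hvcc (constantCoeff_unitPart c hcl st.c)) (inv_ne_zero (constantCoeff_unitPart c hcl st.d)),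
      c := Fin.cases 1 (fun q => if c (l.succAbove q) = 0 then st.c (l.succAbove q) else 0),
      d := Fin.cases (∑ t ∈ J, st.d t + a) (fun q => if c (l.succAbove q) = 0 then st.d (l.succAbove q) else 0),
      c_zero := ?_,
      d_zero := ?_,
      pos_eq := by rw [hGQ]; exact toricStep_pos c hcl _ Ft st.c st.d,
      total_eq := by exact toricStep_total st J c hc l hFa }, l, (J.erase l).filter (fun i => c i ≠ 0), TupleMonomialPhase.sigma l, hlJ,
    Finset.filter_subset _ _, ?_⟩⟩
  · -- cols_zero
    intro t' ht' i
    induction t' using Fin.cases with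
    | zero => exact absurd hT0 ht'
    | succ q =>
      simp only [Fin.cases_succ]
      by_cases h0 : c (l.succAbove q) = 0
      · rw [if_pos h0]; exact st.cols_zero _ (fun hT => ht' ((hTsucc q).mpr ⟨hT, h0⟩)) i
      · rw [if_neg h0]
  · -- col_pos
    intro i
    obtain ⟨t, htT, hpos⟩ := st.col_pos i
    by_cases htJ : t ∈ J
    · refine ⟨0, hT0, ?_⟩
      simp only [Fin.cases_zero]
      exact lt_of_lt_of_le hpos (Finset.single_le_sum (f := fun t => st.cols t i) (fun _ _ => Nat.zero_le _) htJ)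
    · have htl : t ≠ l := fun h => htJ (h ▸ hlJ)
      obtain ⟨q, rfl⟩ := Fin.exists_succAbove_eq htl
      have h0 : c (l.succAbove q) = 0 := by
        by_contra h; exact htJ (hcJ _ h)
      refine ⟨q.succ, (hTsucc q).mpr ⟨htT, h0⟩, ?_⟩
      simp only [Fin.cases_succ]
      rwa [if_pos h0]
  · -- c_zero
    intro t' ht'
    induction t' using Fin.cases with
    | zero => exact absurd hT0 ht'
    | succ q =>
      simp only [Fin.cases_succ]
      by_cases h0 : c (l.succAbove q) = 0
      · rw [if_pos h0]; exact st.c_zero _ (fun hT => ht' ((hTsucc q).mpr ⟨hT, h0⟩))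
      · rw [if_neg h0]
  · -- d_zero
    intro t' ht'
    induction t' using Fin.cases with
    | zero => exact absurd hT0 ht'
    | succ q =>
      simp only [Fin.cases_succ]
      by_cases h0 : c (l.succAbove q) = 0
      · rw [if_pos h0]; exact st.d_zero _ (fun hT => ht' ((hTsucc q).mpr ⟨hT, h0⟩))
      · rw [if_neg h0]
  · -- the cloud of the successor state
    exact toricStep_cloud st.cols J c hcJ l (fun x : ↥S₀ => ((x : Fin (m + 1) →₀ ℕ) : Fin (m + 1) → ℕ))

end NCTransport

end Summit.ResolutionOfSingularities.ResolutionOfSingularities.Theorems
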